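import Literature.NumberTheory.Rogawski1990.LocalTransferRegularSupportNonsplitCM      -- ★ F0P2-p02 (g8): the (T1) headline `exists_localTransfer_of_tsupport_subset_regular_nonsplit`
import Literature.NumberTheory.Rogawski1990.LocalEndoscopicChartDatumCM              -- ★ A-p16 (g26): (2ᵀ) `exists_chartDatum_H_local_centralizer`, (1ᵀ) `exists_chartDatum_cmDatum_local_centralizer_regular_sep`
import Literature.NumberTheory.Rogawski1990.RegularOrbitalIntegralLocallyConstantCM    -- ★ F0P3a-p03 (g10): (G1-i) `eventually_classOrbitalIntegral_mk_eq_cmDatum_local`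
import Literature.NumberTheory.Rogawski1990.LocalTransferRegularCutoff                 -- ★ p840604 F0P3a-p08 (g13): REG-LOCAL ⟸ (T1), `exists_nhds_stableOrbitalIntegralRel_eq_of_regularSupportTransfer`
import HarnessLib

/-!
# (T1) «N6-ns-reg» CLOSED: smooth transfer on the regular set at a non-split place with the chart and local-constancy binders discharged, and the
# local form near every `G`-regular `γ_H` (Rogawski 1990, §4.9 Prop. 4.9.1 (a), §4.3 (4.3.1); Langlands–Shelstad 1990, Thm. 2.3.A, regular case)

Topic `NumberTheory/Rogawski1990`; namespace `Literature.NumberTheory.Rogawski1990`.  THEOREMS ONLY (no definition, no instance, no notation, no named fact,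
no `sorry`; Mathlib-only footing; count-neutral for the books).  Cell `pub/hodgecm-mathlib` (D-0151), crux H413 = stmt-HodgeConjecture-24833, F0∕P3a road «D-N6-ns»,
brick (o1) «(T1) CLOSED» of F0P3a-p08 (g13) (LEAD F0P3a-plan (g9) T8-31 (3), T8-38 (4), T8-49).  HONEST LABEL: HC_CM is proved only modulo the printed citations until
rung 0 closes; this file proves no letter — it plugs the three named feeders of F0P2-p02 (g8)'s (T1) headline ★ `exists_localTransfer_of_tsupport_subset_regular_nonsplit`
(the `H_v`-chart datum `hchartH` = A-p16 (g26) ★ `exists_chartDatum_H_local_centralizer`; the `G′_v`-chart datum `hchartG` = ★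
`exists_chartDatum_cmDatum_local_centralizer_regular_sep`; the local constancy `hOlcG` = F0P3a-p03 (g10) ★ `eventually_classOrbitalIntegral_mk_eq_cmDatum_local`) BY NAME,
so that (T1) holds with no hypothesis beyond the frame, and then reads it through the clopen characteristic-polynomial cut-off ★
`exists_nhds_stableOrbitalIntegralRel_eq_of_regularSupportTransfer` (p840604) in the binder currency of `stub_N6nsRegLocal` of the floor-2 line «N6nsGerm» (A-p12 (g18)).

* §1 **`exists_localTransfer_of_tsupport_subset_regular_nonsplit_closed`** — (T1) at a non-split `v`: for `H′` hermitian with `det H′ ≠ 0`, the explicit factor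
  `Δ‴_v = (finExplicitCollection L H′ μ hl hr) v` and CANONICAL orbital measure families, every `φ ∈ C_c^∞(G′_v)` supported in the regular set has a `C_c^∞` transfer.
* §2 **`exists_nhds_stableOrbitalIntegralRel_eq_nonsplit`** — REG-LOCAL at a frame: for every `φ ∈ C_c^∞(G′_v)` and every `G`-regular `εH`, (4.9.1) holds near `εH` for some
  `φ^H ∈ C_c^∞(H_v)`.
* §3 **`exists_nhds_stableOrbitalIntegralRel_eq_of_subsingleton`** — the same in the letter's binder currency (`H′` anisotropic ⇒ `det H′ ≠ 0`; `Subsingleton (PlacesOver L v)` ⇒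
  the fixed place `w ∣ v`; `hl`, `hr` := ★ `finExplicitDelta_conj_left_all` ∕ `…_right_all`) = the body of `stub_N6nsRegLocal` (the idle μ-guards omitted).

## References
* [Rogawski1990] J. D. Rogawski, *Automorphic Representations of Unitary Groups in Three Variables*, Ann. of Math. Stud. 123 (1990): §4.9 Prop. 4.9.1 (a) pp. 54–55;
  §4.3 (4.3.1) p. 43; §3.1 p. 19.
* [LanglandsShelstad1990Descent] R. P. Langlands, D. Shelstad, *Descent for transfer factors*, The Grothendieck Festschrift II (1990): Thm. 2.3.A (regular case).
* [LanglandsShelstad1987] R. P. Langlands, D. Shelstad, *On the definition of transfer factors*, Math. Ann. 278 (1987), §1.3.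
* [CasselsFrohlichANT1967] J. W. S. Cassels, A. Fröhlich (eds.), *Algebraic Number Theory* (1967): Ch. VII Prop. 1.2 (ii) (places above `v` are Galois-conjugate).
-/

set_option autoImplicit false

noncomputable section

open NumberField IsDedekindDomain MeasureTheory Measure Topology Filter
open scoped Matrix MatrixGroups

namespace Literature.NumberTheory.Rogawski1990

open Literature.NumberTheory.Automorphic Literature.NumberTheory.Automorphic.UnitaryGroup Literature.NumberTheory.GaloisRepresentations

section Frame

variable (L : Type) [Field L] [NumberField L] [IsCMField L] (H' : Matrix (Fin 3) (Fin 3) L) (v : HeightOneSpectrum (𝓞 ↥(maximalRealSubfield L)))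
  [MeasurableSpace ((cmDatum L 2 (Matrix.of fun i j : Fin 2 => if i.val + j.val + 1 = 2 then (1 : L) else 0)).Local v ×
      (cmDatum L 1 (Matrix.of fun i j : Fin 1 => if i.val + j.val + 1 = 1 then (1 : L) else 0)).Local v)]
  [BorelSpace ((cmDatum L 2 (Matrix.of fun i j : Fin 2 => if i.val + j.val + 1 = 2 then (1 : L) else 0)).Local v ×
      (cmDatum L 1 (Matrix.of fun i j : Fin 1 => if i.val + j.val + 1 = 1 then (1 : L) else 0)).Local v)]
  [MeasurableSpace ((cmDatum L 3 H').Local v)] [BorelSpace ((cmDatum L 3 H').Local v)]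
  [iM' : ∀ γ : (cmDatum L 3 H').Local v, MeasurableSpace ((cmDatum L 3 H').Local v ⧸ Subgroup.centralizer ({γ} : Set ((cmDatum L 3 H').Local v)))]
  [iB' : ∀ γ : (cmDatum L 3 H').Local v, BorelSpace ((cmDatum L 3 H').Local v ⧸ Subgroup.centralizer ({γ} : Set ((cmDatum L 3 H').Local v)))]
  [iH : ∀ a : ((cmDatum L 2 (Matrix.of fun i j : Fin 2 => if i.val + j.val + 1 = 2 then (1 : L) else 0)).Local v ×
      (cmDatum L 1 (Matrix.of fun i j : Fin 1 => if i.val + j.val + 1 = 1 then (1 : L) else 0)).Local v),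
    MeasurableSpace (((cmDatum L 2 (Matrix.of fun i j : Fin 2 => if i.val + j.val + 1 = 2 then (1 : L) else 0)).Local v ×
      (cmDatum L 1 (Matrix.of fun i j : Fin 1 => if i.val + j.val + 1 = 1 then (1 : L) else 0)).Local v) ⧸
      Subgroup.centralizer ({a} : Set ((cmDatum L 2 (Matrix.of fun i j : Fin 2 => if i.val + j.val + 1 = 2 then (1 : L) else 0)).Local v ×
        (cmDatum L 1 (Matrix.of fun i j : Fin 1 => if i.val + j.val + 1 = 1 then (1 : L) else 0)).Local v)))]
  [iHB : ∀ a : ((cmDatum L 2 (Matrix.of fun i j : Fin 2 => if i.val + j.val + 1 = 2 then (1 : L) else 0)).Local v ×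
      (cmDatum L 1 (Matrix.of fun i j : Fin 1 => if i.val + j.val + 1 = 1 then (1 : L) else 0)).Local v),
    BorelSpace (((cmDatum L 2 (Matrix.of fun i j : Fin 2 => if i.val + j.val + 1 = 2 then (1 : L) else 0)).Local v ×
      (cmDatum L 1 (Matrix.of fun i j : Fin 1 => if i.val + j.val + 1 = 1 then (1 : L) else 0)).Local v) ⧸
      Subgroup.centralizer ({a} : Set ((cmDatum L 2 (Matrix.of fun i j : Fin 2 => if i.val + j.val + 1 = 2 then (1 : L) else 0)).Local v ×
        (cmDatum L 1 (Matrix.of fun i j : Fin 1 => if i.val + j.val + 1 = 1 then (1 : L) else 0)).Local v)))]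
  (w : PlacesOver L v) (hw : IsCMField.complexConj L • w.1 = w.1)
  (hH' : (H'.map (cmConjRingHom L))ᵀ = H') (hdet' : H'.det ≠ 0) (μ : HeckeCharacter L)
  (hl : ∀ (v : HeightOneSpectrum (𝓞 ↥(maximalRealSubfield L)))
    (a : ((cmDatum L 2 (Matrix.of fun i j : Fin 2 => if i.val + j.val + 1 = 2 then (1 : L) else 0)).Local v ×
      (cmDatum L 1 (Matrix.of fun i j : Fin 1 => if i.val + j.val + 1 = 1 then (1 : L) else 0)).Local v)) (b : (cmDatum L 3 H').Local v)
    (x : ((cmDatum L 2 (Matrix.of fun i j : Fin 2 => if i.val + j.val + 1 = 2 then (1 : L) else 0)).Local v ×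
      (cmDatum L 1 (Matrix.of fun i j : Fin 1 => if i.val + j.val + 1 = 1 then (1 : L) else 0)).Local v)),
      finExplicitDelta L v H' (x * a * x⁻¹) μ b = finExplicitDelta L v H' a μ b)
  (hr : ∀ (v : HeightOneSpectrum (𝓞 ↥(maximalRealSubfield L)))
    (a : ((cmDatum L 2 (Matrix.of fun i j : Fin 2 => if i.val + j.val + 1 = 2 then (1 : L) else 0)).Local v ×
      (cmDatum L 1 (Matrix.of fun i j : Fin 1 => if i.val + j.val + 1 = 1 then (1 : L) else 0)).Local v)) (b y : (cmDatum L 3 H').Local v),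
      finExplicitDelta L v H' a μ (y * b * y⁻¹) = finExplicitDelta L v H' a μ b)
  (νH : Measure ((cmDatum L 2 (Matrix.of fun i j : Fin 2 => if i.val + j.val + 1 = 2 then (1 : L) else 0)).Local v ×
      (cmDatum L 1 (Matrix.of fun i j : Fin 1 => if i.val + j.val + 1 = 1 then (1 : L) else 0)).Local v)) [νH.IsHaarMeasure] [νH.IsMulRightInvariant]
  (νG : Measure ((cmDatum L 3 H').Local v)) [νG.IsHaarMeasure] [νG.IsMulRightInvariant]
  {mH : OrbitalMeasureFamily ((cmDatum L 2 (Matrix.of fun i j : Fin 2 => if i.val + j.val + 1 = 2 then (1 : L) else 0)).Local v ×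
      (cmDatum L 1 (Matrix.of fun i j : Fin 1 => if i.val + j.val + 1 = 1 then (1 : L) else 0)).Local v)}
  {mG : OrbitalMeasureFamily ((cmDatum L 3 H').Local v)}
  (hmH : mH.IsCanonical (IsLocalGRegular L v) νH)
  (hmG : mG.IsCanonical (fun γ : (cmDatum L 3 H').Local v => IsRegularElt (γ.val : GL (Fin 3) (LocalRing L v))) νG)

include hw hH' hdet' hmH hmG

/-! ## §1 (T1) with the three feeders plugged in -/

/-- **(T1) «N6-ns-reg» — SMOOTH TRANSFER ON THE REGULAR SET AT A NON-SPLIT PLACE, with the chart data and the local constancy SUPPLIED.**  `v` non-split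
(`w ∣ v`, `w̄ = w`), `H′` hermitian with `det H′ ≠ 0`, `Δ_v = (finExplicitCollection L H′ μ hl hr) v`, `mH`, `mG` canonical: every `φ ∈ C_c^∞(G′_v)` with
`tsupport φ ⊆ G′_v^{reg}` has `φ^H ∈ C_c^∞(H_v)` with `Φ^st(γ_H, φ^H) = Σ_{[γ]} Δ_v(γ_H, γ) Φ([γ], φ)` for every `G`-regular `γ_H` — ★
`exists_localTransfer_of_tsupport_subset_regular_nonsplit` (F0P2-p02; his ED. 2 rider `…_of_charts` discharges `hOlcG` only) with `hchartH` := ★ `forall_isLocalGRegular_exists_chartDatum_H_local_centralizer` (A-p16), `hchartG` := ★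
`exists_chartDatum_cmDatum_local_centralizer_regular_sep` (A-p16), `hOlcG` := ★ `eventually_classOrbitalIntegral_mk_eq_cmDatum_local` (F0P3a-p03).
[cite: Rogawski1990, §4.9 Prop. 4.9.1 (a) pp. 54–55; §4.3 (4.3.1) p. 43] [cite: LanglandsShelstad1987, §1.3] -/
theorem exists_localTransfer_of_tsupport_subset_regular_nonsplit_closed (φ : (cmDatum L 3 H').Local v → ℂ) (hφ : IsLocSmooth φ)
    (hφreg : tsupport φ ⊆ {γ : (cmDatum L 3 H').Local v | IsRegularElt (γ.val : GL (Fin 3) (LocalRing L v))}) :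
    ∃ φH : ((cmDatum L 2 (Matrix.of fun i j : Fin 2 => if i.val + j.val + 1 = 2 then (1 : L) else 0)).Local v ×
        (cmDatum L 1 (Matrix.of fun i j : Fin 1 => if i.val + j.val + 1 = 1 then (1 : L) else 0)).Local v) → ℂ,
      IsLocSmooth φH ∧ IsLocalDeltaTransfer L H' v ((finExplicitCollection L H' μ hl hr) v) mH mG φH φ := by
  have hJ : (H'.map (IsCMField.complexConj L))ᵀ = H' := hH'
  have hHd : IsUnit H'.det := isUnit_iff_ne_zero.2 hdet'
  exact exists_localTransfer_of_tsupport_subset_regular_nonsplit L H' v w hw hH' hdet' μ hl hr νH νG hmH hmG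
    (forall_isLocalGRegular_exists_chartDatum_H_local_centralizer L w hw)
    (fun γ₀ hγ₀ => exists_chartDatum_cmDatum_local_centralizer_regular_sep L H' hHd w hw γ₀ hγ₀)
    (fun γ₀ hγ₀ ψ hψ t₀ ht₀ => eventually_classOrbitalIntegral_mk_eq_cmDatum_local L H' hJ hHd w hw hmG hγ₀ hψ t₀ ht₀)
    φ hφ hφreg

/-! ## §2 REG-LOCAL at a frame -/

/-- **REG-LOCAL AT A NON-SPLIT PLACE — (4.9.1) NEAR EVERY `G`-REGULAR `γ_H`, FOR EVERY TEST FUNCTION.**  Same frame; for every `φ ∈ C_c^∞(G′_v)` (any support) and every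
`G`-regular `εH ∈ H_v` there are a neighbourhood `V` of `εH` and `φ^H ∈ C_c^∞(H_v)` with `Φ^st(γ_H, φ^H) = Σ_{[γ]} Δ_v(γ_H, γ) Φ([γ], φ)` for all `G`-regular `γ_H ∈ V`
(§1 through the clopen characteristic-polynomial cut-off ★ `exists_nhds_stableOrbitalIntegralRel_eq_of_regularSupportTransfer`).
[cite: Rogawski1990, §4.9 Prop. 4.9.1 (a) pp. 54–55; §4.3 (4.3.1) p. 43] [cite: LanglandsShelstad1990Descent, Thm. 2.3.A] -/
theorem exists_nhds_stableOrbitalIntegralRel_eq_nonsplit (φ : (cmDatum L 3 H').Local v → ℂ) (hφ : IsLocSmooth φ)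
    (εH : (cmDatum L 2 (Matrix.of fun i j : Fin 2 => if i.val + j.val + 1 = 2 then (1 : L) else 0)).Local v ×
      (cmDatum L 1 (Matrix.of fun i j : Fin 1 => if i.val + j.val + 1 = 1 then (1 : L) else 0)).Local v)
    (hε : IsLocalGRegular L v εH) :
    ∃ V ∈ 𝓝 εH, ∃ φH : ((cmDatum L 2 (Matrix.of fun i j : Fin 2 => if i.val + j.val + 1 = 2 then (1 : L) else 0)).Local v ×
        (cmDatum L 1 (Matrix.of fun i j : Fin 1 => if i.val + j.val + 1 = 1 then (1 : L) else 0)).Local v) → ℂ, IsLocSmooth φH ∧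
      ∀ γH ∈ V, IsLocalGRegular L v γH →
        stableOrbitalIntegralRel (IsLocalStablyConjH L v) mH φH γH =
          ∑ᶠ c : ConjClasses ((cmDatum L 3 H').Local v), ((finExplicitCollection L H' μ hl hr) v).Δ γH (Quotient.out c) * classOrbitalIntegral mG φ c :=
  exists_nhds_stableOrbitalIntegralRel_eq_of_regularSupportTransfer L H' v w hw ((finExplicitCollection L H' μ hl hr) v) mH mG
    (fun ψ hψ hψreg => exists_localTransfer_of_tsupport_subset_regular_nonsplit_closed L H' v w hw hH' hdet' μ hl hr νH νG hmH hmG ψ hψ hψreg)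
    φ hφ εH hε

end Frame

/-! ## §3 In the letter's binder currency (`stub_N6nsRegLocal`) -/

section Letter

/-- `H′` anisotropic ⇒ `det H′ ≠ 0` (a kernel vector is isotropic). Local copy of ★ `det_ne_zero_of_anisotropic`. [cite: Rogawski1990, §4.9 p. 54] -/
private theorem det_ne_zero_of_anisotropic₅ {L : Type} [Field L] [NumberField L] [IsCMField L] {H : Matrix (Fin 3) (Fin 3) L}
    (hH0 : ∀ x : Fin 3 → L, Literature.AlgebraicGeometry.ShimuraVarieties.hermForm (cmConjRingHom L) H x x = 0 → x = 0) : H.det ≠ 0 := by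
  intro hdet
  obtain ⟨x, hx, hHx⟩ := Matrix.exists_mulVec_eq_zero_iff.mpr hdet
  refine hx (hH0 x ?_)
  rw [Literature.AlgebraicGeometry.ShimuraVarieties.hermForm, hHx, dotProduct_zero]

/-- At a place with ONE prime of `L` above it, that prime is fixed by complex conjugation (local copy of ★ `smul_eq_of_subsingleton_placesOver`).
[cite: CasselsFrohlichANT1967, Ch. VII Prop. 1.2 (ii)] -/
private theorem smul_eq_of_subsingleton_placesOver₂ (L : Type) [Field L] [NumberField L] [IsCMField L] {v : HeightOneSpectrum (𝓞 ↥(maximalRealSubfield L))}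
    (hv : Subsingleton (PlacesOver L v)) (w : PlacesOver L v) : IsCMField.complexConj L • w.1 = w.1 := by
  have hmem : (IsCMField.complexConj L • w.1).under (𝓞 ↥(maximalRealSubfield L)) = v := by
    rw [HeightOneSpectrum.under_algEquiv_smul]; exact w.2
  exact congrArg Subtype.val (Subsingleton.elim (⟨IsCMField.complexConj L • w.1, hmem⟩ : PlacesOver L v) w)

/-- **REG-LOCAL IN THE LETTER'S CURRENCY = the body of `stub_N6nsRegLocal` of the floor-2 line «N6nsGerm»** (A-p12 (g18); the idle μ-guards `μ.IsUnitary`,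
`μ|_{𝕀_{L⁺}} = ω` are omitted — the explicit factor `Δ‴_v` is defined for every `μ`): `H′` hermitian anisotropic, `v` with one place above it, canonical families; for
every `φ ∈ C_c^∞(G′_v)` and `G`-regular `εH`, (4.9.1) at `Δ‴_v = (finExplicitCollection L H′ μ (finExplicitDelta_conj_left_all …) (finExplicitDelta_conj_right_all …)) v`
holds near `εH` for some `φ^H ∈ C_c^∞(H_v)`. [cite: Rogawski1990, §4.9 Prop. 4.9.1 (a) pp. 54–55; §4.3 (4.3.1) p. 43] [cite: LanglandsShelstad1990Descent, Thm. 2.3.A] -/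
theorem exists_nhds_stableOrbitalIntegralRel_eq_of_subsingleton (L : Type) [Field L] [NumberField L] [IsCMField L] (H' : Matrix (Fin 3) (Fin 3) L)
    (μ : HeckeCharacter L) (hherm : (H'.map (cmConjRingHom L)).transpose = H') (hanis : ∀ x : Fin 3 → L, Literature.AlgebraicGeometry.ShimuraVarieties.hermForm (cmConjRingHom L) H' x x = 0 → x = 0)
    (v : HeightOneSpectrum (𝓞 ↥(maximalRealSubfield L))) (hv : Subsingleton (PlacesOver L v))
    [MeasurableSpace ((cmDatum L 2 (Matrix.of fun i j : Fin 2 => if i.val + j.val + 1 = 2 then (1 : L) else 0)).Local v ×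
        (cmDatum L 1 (Matrix.of fun i j : Fin 1 => if i.val + j.val + 1 = 1 then (1 : L) else 0)).Local v)]
    [BorelSpace ((cmDatum L 2 (Matrix.of fun i j : Fin 2 => if i.val + j.val + 1 = 2 then (1 : L) else 0)).Local v ×
        (cmDatum L 1 (Matrix.of fun i j : Fin 1 => if i.val + j.val + 1 = 1 then (1 : L) else 0)).Local v)]
    [MeasurableSpace ((cmDatum L 3 H').Local v)] [BorelSpace ((cmDatum L 3 H').Local v)]
    [iH : ∀ a : ((cmDatum L 2 (Matrix.of fun i j : Fin 2 => if i.val + j.val + 1 = 2 then (1 : L) else 0)).Local v ×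
        (cmDatum L 1 (Matrix.of fun i j : Fin 1 => if i.val + j.val + 1 = 1 then (1 : L) else 0)).Local v),
      MeasurableSpace (((cmDatum L 2 (Matrix.of fun i j : Fin 2 => if i.val + j.val + 1 = 2 then (1 : L) else 0)).Local v ×
        (cmDatum L 1 (Matrix.of fun i j : Fin 1 => if i.val + j.val + 1 = 1 then (1 : L) else 0)).Local v) ⧸
        Subgroup.centralizer ({a} : Set ((cmDatum L 2 (Matrix.of fun i j : Fin 2 => if i.val + j.val + 1 = 2 then (1 : L) else 0)).Local v ×
          (cmDatum L 1 (Matrix.of fun i j : Fin 1 => if i.val + j.val + 1 = 1 then (1 : L) else 0)).Local v)))]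
    [bH : ∀ a : ((cmDatum L 2 (Matrix.of fun i j : Fin 2 => if i.val + j.val + 1 = 2 then (1 : L) else 0)).Local v ×
        (cmDatum L 1 (Matrix.of fun i j : Fin 1 => if i.val + j.val + 1 = 1 then (1 : L) else 0)).Local v),
      BorelSpace (((cmDatum L 2 (Matrix.of fun i j : Fin 2 => if i.val + j.val + 1 = 2 then (1 : L) else 0)).Local v ×
        (cmDatum L 1 (Matrix.of fun i j : Fin 1 => if i.val + j.val + 1 = 1 then (1 : L) else 0)).Local v) ⧸
        Subgroup.centralizer ({a} : Set ((cmDatum L 2 (Matrix.of fun i j : Fin 2 => if i.val + j.val + 1 = 2 then (1 : L) else 0)).Local v ×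
          (cmDatum L 1 (Matrix.of fun i j : Fin 1 => if i.val + j.val + 1 = 1 then (1 : L) else 0)).Local v)))]
    [iG : ∀ γ : (cmDatum L 3 H').Local v, MeasurableSpace ((cmDatum L 3 H').Local v ⧸ Subgroup.centralizer ({γ} : Set ((cmDatum L 3 H').Local v)))]
    [bG : ∀ γ : (cmDatum L 3 H').Local v, BorelSpace ((cmDatum L 3 H').Local v ⧸ Subgroup.centralizer ({γ} : Set ((cmDatum L 3 H').Local v)))]
    (νH : Measure ((cmDatum L 2 (Matrix.of fun i j : Fin 2 => if i.val + j.val + 1 = 2 then (1 : L) else 0)).Local v ×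
        (cmDatum L 1 (Matrix.of fun i j : Fin 1 => if i.val + j.val + 1 = 1 then (1 : L) else 0)).Local v)) [νH.IsHaarMeasure] [νH.IsMulRightInvariant]
    (νG : Measure ((cmDatum L 3 H').Local v)) [νG.IsHaarMeasure] [νG.IsMulRightInvariant]
    (mH : OrbitalMeasureFamily ((cmDatum L 2 (Matrix.of fun i j : Fin 2 => if i.val + j.val + 1 = 2 then (1 : L) else 0)).Local v ×
        (cmDatum L 1 (Matrix.of fun i j : Fin 1 => if i.val + j.val + 1 = 1 then (1 : L) else 0)).Local v))
    (mG : OrbitalMeasureFamily ((cmDatum L 3 H').Local v))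
    (hmH : mH.IsCanonical (IsLocalGRegular L v) νH)
    (hmG : mG.IsCanonical (fun γ : (cmDatum L 3 H').Local v => IsRegularElt (γ.val : GL (Fin 3) (LocalRing L v))) νG)
    (φ : (cmDatum L 3 H').Local v → ℂ) (hφ : IsLocSmooth φ)
    (εH : (cmDatum L 2 (Matrix.of fun i j : Fin 2 => if i.val + j.val + 1 = 2 then (1 : L) else 0)).Local v ×
        (cmDatum L 1 (Matrix.of fun i j : Fin 1 => if i.val + j.val + 1 = 1 then (1 : L) else 0)).Local v)
    (hε : IsLocalGRegular L v εH) :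
    ∃ V ∈ 𝓝 εH, ∃ φH : ((cmDatum L 2 (Matrix.of fun i j : Fin 2 => if i.val + j.val + 1 = 2 then (1 : L) else 0)).Local v ×
        (cmDatum L 1 (Matrix.of fun i j : Fin 1 => if i.val + j.val + 1 = 1 then (1 : L) else 0)).Local v) → ℂ, IsLocSmooth φH ∧
      ∀ γH ∈ V, IsLocalGRegular L v γH →
        stableOrbitalIntegralRel (IsLocalStablyConjH L v) mH φH γH =
          ∑ᶠ c : ConjClasses ((cmDatum L 3 H').Local v),
            ((finExplicitCollection L H' μ (finExplicitDelta_conj_left_all L H' μ) (finExplicitDelta_conj_right_all L H' μ)) v).Δ γH (Quotient.out c) *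
              classOrbitalIntegral mG φ c := by
  obtain ⟨w⟩ := PlacesOver.nonempty L v
  exact exists_nhds_stableOrbitalIntegralRel_eq_nonsplit L H' v w (smul_eq_of_subsingleton_placesOver₂ L hv w) hherm (det_ne_zero_of_anisotropic₅ hanis) μ
    (finExplicitDelta_conj_left_all L H' μ) (finExplicitDelta_conj_right_all L H' μ) νH νG hmH hmG φ hφ εH hε

end Letter

end Literature.NumberTheory.Rogawski1990

end
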